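import Summits.NavierStokesRegularity.NavierStokesRegularity.Theorems.ExtremiserTransienceNearExtremalTransienceExtremiserLiouvilleConstantSpeedDiscreteProductRule
import HarnessLib

/-!
# Crux `ExtremiserTransience.NearExtremalTransience` (stmt-NavierStokesRegularity-21883), line `extremiser_liouville`,
# stub K1b — the discrete product rule in the SHIFTED, NORMALISED form used by the palinstrophy bound (record §13, R3)

`--supports stmt-NavierStokesRegularity-21883` (helper).  Author: prover seat `ns-el-k1b` (g8).  Corollary of
`neg_integral_axialWeight_inner_backwardQuotient_le` (…DiscreteProductRule) with the shifted weight `s ↦ g(s − h)` and the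
normalisation `h⁻¹`:
* `neg_integral_shiftedWeight_inner_backwardQuotient_le` : for `F` continuous with `‖F‖² ∈ L¹`, `g ≥ 0` continuous bounded,
  `h > 0`:  **`−∫ g(x₂−h)⟪F(x), h⁻¹(F(x) − F(x−he₂))⟫ ≤ ½∫ h⁻¹(g(x₂) − g(x₂−h))‖F(x)‖²`**.
This is the inequality that bounds the `D³V`-looking part of `c₁(−h⁻¹φ̂_h)` (with `F = ∂ᵢω`): the favourable-sign remainder
`½h⁻¹∫g(x₂−h)‖F − F(·−he₂)‖²` is dropped, and `h⁻¹(g(x₂) − g(x₂−h)) → g′(x₂)`.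

WHAT THIS IS NOT: K1b is NOT proved; nothing here proves NS regularity. [folklore]
-/

noncomputable section

open Set Filter Topology MeasureTheory Metric Function InnerProductSpace
open scoped ENNReal NNReal Topology InnerProductSpace RealInnerProductSpace ContDiff
open Literature.Analysis.FluidPDE Literature.Analysis

namespace Summit.NavierStokesRegularity.NavierStokesRegularity.Theorems

-- the problem directory repeats the summit name (`NavierStokesRegularity/NavierStokesRegularity`)
set_option linter.dupNamespace false

namespace ExtremiserLiouville

open DepletionLadder.KStar

variable {F : EuclideanSpace ℝ (Fin 3) → EuclideanSpace ℝ (Fin 3)} {g : ℝ → ℝ}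

/-- **Shifted, normalised discrete product rule**: for `F` continuous with `‖F‖² ∈ L¹`, `g ≥ 0` continuous with `|g| ≤ K`,
and `h > 0`:  `−∫ g(x₂−h)⟪F(x), h⁻¹(F(x) − F(x−he₂))⟫ ≤ ½∫ h⁻¹(g(x₂) − g(x₂−h))‖F(x)‖²`. [folklore] -/
theorem neg_integral_shiftedWeight_inner_backwardQuotient_le (hF : Continuous F)
    (hF2 : Integrable (fun x => ‖F x‖ ^ 2) volume) (hg : Continuous g) {K : ℝ} (hgK : ∀ s, |g s| ≤ K)
    (hg0 : ∀ s, 0 ≤ g s) {h : ℝ} (hh : 0 < h) :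
    -(∫ x, g (x 2 - h) * ⟪F x, h⁻¹ • (F x - F (x - h • EuclideanSpace.single (2 : Fin 3) (1 : ℝ)))⟫) ≤
      (1 / 2) * ∫ x, (h⁻¹ * (g (x 2) - g (x 2 - h))) * ‖F x‖ ^ 2 := by
  set e₂ : EuclideanSpace ℝ (Fin 3) := EuclideanSpace.single (2 : Fin 3) (1 : ℝ) with he₂
  -- the shifted weight
  have hgs : Continuous fun s : ℝ => g (s - h) := hg.comp (continuous_id.sub continuous_const)
  have hgsK : ∀ s, |(fun s : ℝ => g (s - h)) s| ≤ K := fun s => hgK _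
  have hgs0 : ∀ s, 0 ≤ (fun s : ℝ => g (s - h)) s := fun s => hg0 _
  have key := neg_integral_axialWeight_inner_backwardQuotient_le hF hF2 hgs hgsK hgs0 h
  simp only [add_sub_cancel_right] at key
  -- `key : −∫ g(x₂−h)⟪F, F − F₋⟫ ≤ ½∫(g(x₂) − g(x₂−h))‖F‖²`; scale by `h⁻¹ > 0`
  have e1 : (∫ x, g (x 2 - h) * ⟪F x, h⁻¹ • (F x - F (x - h • e₂))⟫) =
      h⁻¹ * ∫ x, g (x 2 - h) * ⟪F x, F x - F (x - h • e₂)⟫ := by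
    rw [← integral_const_mul]
    refine integral_congr_ae (Eventually.of_forall fun x => ?_)
    simp only [real_inner_smul_right]
    ring
  have e2 : (∫ x, (h⁻¹ * (g (x 2) - g (x 2 - h))) * ‖F x‖ ^ 2) = h⁻¹ * ∫ x, (g (x 2) - g (x 2 - h)) * ‖F x‖ ^ 2 := by
    rw [← integral_const_mul]
    refine integral_congr_ae (Eventually.of_forall fun x => ?_)
    ring
  rw [e1, e2, ← mul_neg, show (1 / 2 : ℝ) * (h⁻¹ * ∫ x, (g (x 2) - g (x 2 - h)) * ‖F x‖ ^ 2) =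
    h⁻¹ * ((1 / 2) * ∫ x, (g (x 2) - g (x 2 - h)) * ‖F x‖ ^ 2) by ring]
  exact mul_le_mul_of_nonneg_left key (inv_nonneg.2 hh.le)

end ExtremiserLiouville

end Summit.NavierStokesRegularity.NavierStokesRegularity.Theorems

end
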